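import Mathlib
import Summits.ValiantsHypothesis.ValiantsHypothesis.Theses.ValuativeGCT
import Literature.Computability.AlgebraicComplexity.OrbitClosureWeights
import Literature.Computability.AlgebraicComplexity.CoordRepRational
import Summits.ValiantsHypothesis.ValiantsHypothesis.Theorems.ValuativeGCTCutBitesHwExtraction
import Summits.ValiantsHypothesis.ValiantsHypothesis.Theorems.ValuativeGCTValuativeFlipMultiplicityCount
import Summits.ValiantsHypothesis.ValiantsHypothesis.Theorems.ValuativeGCTValuativeFlipFourRowBridgeBlock
import Summits.ValiantsHypothesis.ValiantsHypothesis.Theorems.ValuativeGCTValuativeFlipFourRowBridgePer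

/-!
# The four-row bridge, core: counting over the Levi block `GL(K)` (four-row bridge, part 3)

Crux `ValuativeGCT.ValuativeFlip` (stmt-ValiantsHypothesis-12624), line `four-row-count`, stub
`stub_fourRowBridge`.  `W = ℂ^{m×m}`, `R = ℂ[End W] = MvPolynomial (MatIdx m × MatIdx m) ℂ`
(variables `X (j, i)`, row slot `j`, matrix position `i`), `K = {p}` an upper set of row slots,
`Φ = genericOrbitMap (X₀₀^{m-n} per_n) m`.

`frb_bridge_core`: let `S_D, S_P ⊆ R` be finite-dimensional subspaces, `S_D` stable under the left action of
the block embedding of every `B ∈ Mat(K)`, `S_P` stable under that of every `b⁻¹`, `b ∈ GL(K)`, consisting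
of functions of the `K`-rows and contained in `Φ(ℂ[Sym^m W]_δ)`.  If `dim S_D < dim S_P` then there are a
weight `χ₄` of `GL(K)` and a partition `λ ⊢ mδ` (`≤ m²` parts) with `χ̃ = λ*` (`χ̃` = extension of `χ₄` by
zero — so `λ*` vanishes off `K`) and `dim (S_D ⊓ HWSP(λ*)) < mult_{λ*} ℂ[Δ_m(X₀₀^{m-n} per_n)]`.
Proof: `S_D`, `S_P` are rational `GL(K)`-representations by left translation through the block embedding
(built inside the proof, no definitions; rationality since matrix coefficients are polynomial in the acting
matrix, `frb_exists_eval_blk`); the counting lemma B4 `stub_multiplicityCount` (`σ := K`) gives `χ₄` with a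
multiplicity gap; per side, block-Borel semi-invariants are crux highest-weight vectors of weight `χ̃`
(`fourRow_borel_of_blockBorel`), pinned to `λ*` (`frb_exists_partition_of_hwv`) and counted by
`orbitMultiplicity` (`fourRow_hwsp_inf_map_genericOrbitMap_le_orbitMultiplicity`); det side, weight-`λ*` crux
semi-invariants in `S_D` are `χ₄`-semi-invariants (`frb_blockBorel_of_borel`).
BLMW 2011 §5.2; Goodman–Wallach §3.2, §4.1. [folklore]
-/

-- `Summit.ValiantsHypothesis.ValiantsHypothesis.…` is the tree's mandated single-conjunct layout (Sub = Summit).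
set_option linter.dupNamespace false

namespace Summit.ValiantsHypothesis.ValiantsHypothesis.Theorems.ValuativeFlip

open MvPolynomial
open scoped BigOperators Matrix
open Literature.NumberTheory.DiophantineGeometry
open Literature.Computability.AlgebraicComplexity
open Summit.ValiantsHypothesis.ValiantsHypothesis.Theorems.CutBitesAdjugate

noncomputable section

/-- Entries of the block embedding are polynomial in the entries of the embedded matrix: a polynomial in
the entries of `blk(B)` is a polynomial in the entries of `B`. [folklore] -/
theorem frb_exists_eval_blk {m : ℕ} (p : MatIdx m → Prop) [DecidablePred p]
    (Q₀ : MvPolynomial (MatIdx m × MatIdx m) ℂ) :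
    ∃ Q : MvPolynomial ({a // p a} × {a // p a}) ℂ, ∀ B : Matrix {a // p a} {a // p a} ℂ,
      MvPolynomial.eval (fun ij : MatIdx m × MatIdx m =>
          Matrix.reindex (Equiv.sumCompl p) (Equiv.sumCompl p)
            (Matrix.fromBlocks B 0 0 (1 : Matrix {a // ¬ p a} {a // ¬ p a} ℂ)) ij.1 ij.2) Q₀ =
        MvPolynomial.eval (fun ij : {a // p a} × {a // p a} => B ij.1 ij.2) Q := by
  classical
  refine ⟨MvPolynomial.aeval (fun q : MatIdx m × MatIdx m =>
      if ha : p q.1 then (if hb : p q.2 then (X (⟨q.1, ha⟩, ⟨q.2, hb⟩) : MvPolynomial ({a // p a} × {a // p a}) ℂ)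
        else 0)
      else (if p q.2 then 0 else if q.1 = q.2 then 1 else 0)) Q₀, fun B => ?_⟩
  rw [frb_eval_aeval]
  refine congrArg (fun f : MatIdx m × MatIdx m → ℂ => MvPolynomial.eval f Q₀) ?_
  funext q
  by_cases ha : p q.1 <;> by_cases hb : p q.2
  · rw [frb_blk_apply_pos_pos p B ha hb, dif_pos ha, dif_pos hb, eval_X]
  · rw [frb_blk_apply_pos_neg p B ha hb, dif_pos ha, dif_neg hb, map_zero]
  · rw [frb_blk_apply_neg_pos p B ha hb, dif_neg ha, if_pos hb, map_zero]
  · rw [frb_blk_apply_neg_neg p B ha hb, dif_neg ha, if_neg hb]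
    split_ifs <;> simp

/-- **Core of the four-row bridge: counting over the Levi block `GL(K)`.**  See the module docstring.
[folklore; BLMW 2011 §5.2; Goodman–Wallach §3.2, §4.1] -/
theorem frb_bridge_core {m : ℕ} (p : MatIdx m → Prop) [DecidablePred p]
    (hp : ∀ a b : MatIdx m, a ≤ b → p a → p b) (n δ : ℕ) [NeZero m]
    (SD SP : Submodule ℂ (MvPolynomial (MatIdx m × MatIdx m) ℂ))
    [FiniteDimensional ℂ ↥SD] [FiniteDimensional ℂ ↥SP]
    (hSD_stab : ∀ (B : Matrix {a // p a} {a // p a} ℂ), ∀ G ∈ SD,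
      MvPolynomial.aeval (R := ℂ) (fun q : MatIdx m × MatIdx m =>
        ∑ l : MatIdx m, Matrix.reindex (Equiv.sumCompl p) (Equiv.sumCompl p)
          (Matrix.fromBlocks B 0 0 (1 : Matrix {a // ¬ p a} {a // ¬ p a} ℂ)) q.1 l •
            (X (l, q.2) : MvPolynomial (MatIdx m × MatIdx m) ℂ)) G ∈ SD)
    (hSP_stab : ∀ (b : GL {a // p a} ℂ), ∀ G ∈ SP,
      MvPolynomial.aeval (R := ℂ) (fun q : MatIdx m × MatIdx m =>
        ∑ l : MatIdx m, Matrix.reindex (Equiv.sumCompl p) (Equiv.sumCompl p)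
          (Matrix.fromBlocks ((b⁻¹ : GL {a // p a} ℂ) : Matrix {a // p a} {a // p a} ℂ) 0 0
            (1 : Matrix {a // ¬ p a} {a // ¬ p a} ℂ)) q.1 l •
            (X (l, q.2) : MvPolynomial (MatIdx m × MatIdx m) ℂ)) G ∈ SP)
    (hSP_rows : ∀ G ∈ SP, G ∈ MvPolynomial.supported ℂ {q : MatIdx m × MatIdx m | p q.1})
    (hSP_le : SP ≤ (MvPolynomial.homogeneousSubmodule (DegIdx (MatIdx m) m) ℂ δ).map
      (genericOrbitMap (paddedPerFormLex ℂ n m) m).toLinearMap)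
    (hgap : Module.finrank ℂ ↥SD < Module.finrank ℂ ↥SP) :
    ∃ (χ₄ : Weight {a // p a}) (lam : Nat.Partition (m * δ)), lam.parts.card ≤ m * m ∧
      (fun a : MatIdx m => if h : p a then χ₄ ⟨a, h⟩ else 0) =
        ((Weight.dualOfPartition (m * m) lam).toMatIdx : Weight (MatIdx m)) ∧
      Module.finrank ℂ ↥(SD ⊓
          (⨅ (g : Matrix.GeneralLinearGroup (MatIdx m) ℂ) (_ : IsUpperTriangular g),
              LinearMap.ker ((MvPolynomial.aeval fun q : MatIdx m × MatIdx m =>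
                  ∑ l : MatIdx m, ((g⁻¹ : Matrix.GeneralLinearGroup (MatIdx m) ℂ) :
                    Matrix (MatIdx m) (MatIdx m) ℂ) q.1 l •
                      (MvPolynomial.X (l, q.2) : MvPolynomial (MatIdx m × MatIdx m) ℂ)).toLinearMap -
                weightChar ((Weight.dualOfPartition (m * m) lam).toMatIdx : Weight (MatIdx m)) g •
                  (LinearMap.id : MvPolynomial (MatIdx m × MatIdx m) ℂ →ₗ[ℂ] MvPolynomial (MatIdx m × MatIdx m) ℂ)))) <
        orbitMultiplicity ℂ (paddedPerFormLex ℂ n m) m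
          ((Weight.dualOfPartition (m * m) lam).toMatIdx : Weight (MatIdx m)) := by
  classical
  have hm0 : m ≠ 0 := NeZero.ne m
  -- unit and multiplicativity of the left action through the block embedding
  have hone : ∀ v : MvPolynomial (MatIdx m × MatIdx m) ℂ, MvPolynomial.aeval (R := ℂ) (fun q : MatIdx m × MatIdx m =>
          ∑ l : MatIdx m, Matrix.reindex (Equiv.sumCompl p) (Equiv.sumCompl p)
          (Matrix.fromBlocks (((1 : GL {a // p a} ℂ)⁻¹ : GL {a // p a} ℂ) : Matrix {a // p a} {a // p a} ℂ) 0 0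
            (1 : Matrix {a // ¬ p a} {a // ¬ p a} ℂ)) q.1 l •
            (X (l, q.2) : MvPolynomial (MatIdx m × MatIdx m) ℂ)) v = v := by
    intro v
    rw [inv_one, Units.val_one, frb_blk_one, hwx_leftAct_one]
  have hmul : ∀ (g h : GL {a // p a} ℂ) (v : MvPolynomial (MatIdx m × MatIdx m) ℂ),
      MvPolynomial.aeval (R := ℂ) (fun q : MatIdx m × MatIdx m =>
          ∑ l : MatIdx m, Matrix.reindex (Equiv.sumCompl p) (Equiv.sumCompl p)
          (Matrix.fromBlocks (((g * h)⁻¹ : GL {a // p a} ℂ) : Matrix {a // p a} {a // p a} ℂ) 0 0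
            (1 : Matrix {a // ¬ p a} {a // ¬ p a} ℂ)) q.1 l •
            (X (l, q.2) : MvPolynomial (MatIdx m × MatIdx m) ℂ)) v =
      MvPolynomial.aeval (R := ℂ) (fun q : MatIdx m × MatIdx m =>
          ∑ l : MatIdx m, Matrix.reindex (Equiv.sumCompl p) (Equiv.sumCompl p)
          (Matrix.fromBlocks ((g⁻¹ : GL {a // p a} ℂ) : Matrix {a // p a} {a // p a} ℂ) 0 0
            (1 : Matrix {a // ¬ p a} {a // ¬ p a} ℂ)) q.1 l •
            (X (l, q.2) : MvPolynomial (MatIdx m × MatIdx m) ℂ))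
        (MvPolynomial.aeval (R := ℂ) (fun q : MatIdx m × MatIdx m =>
          ∑ l : MatIdx m, Matrix.reindex (Equiv.sumCompl p) (Equiv.sumCompl p)
          (Matrix.fromBlocks ((h⁻¹ : GL {a // p a} ℂ) : Matrix {a // p a} {a // p a} ℂ) 0 0
            (1 : Matrix {a // ¬ p a} {a // ¬ p a} ℂ)) q.1 l •
            (X (l, q.2) : MvPolynomial (MatIdx m × MatIdx m) ℂ)) v) := by
    intro g h v
    rw [hwx_leftAct_leftAct, mul_inv_rev, Units.val_mul, frb_blk_mul]
  -- the two representations of `GL(K)` (left translation through the block embedding)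
  let ρD : Representation ℂ (GL {a // p a} ℂ) ↥SD :=
    { toFun := fun b => (MvPolynomial.aeval (R := ℂ) (fun q : MatIdx m × MatIdx m =>
          ∑ l : MatIdx m, Matrix.reindex (Equiv.sumCompl p) (Equiv.sumCompl p)
          (Matrix.fromBlocks ((b⁻¹ : GL {a // p a} ℂ) : Matrix {a // p a} {a // p a} ℂ) 0 0
            (1 : Matrix {a // ¬ p a} {a // ¬ p a} ℂ)) q.1 l •
            (X (l, q.2) : MvPolynomial (MatIdx m × MatIdx m) ℂ))).toLinearMap.restrict (hSD_stab _)
      map_one' := LinearMap.ext fun v => Subtype.ext (by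
        rw [LinearMap.coe_restrict_apply, AlgHom.toLinearMap_apply, Module.End.one_apply]
        exact hone v)
      map_mul' := fun g h => LinearMap.ext fun v => Subtype.ext (by
        rw [Module.End.mul_apply, LinearMap.coe_restrict_apply, LinearMap.coe_restrict_apply,
          LinearMap.coe_restrict_apply, AlgHom.toLinearMap_apply, AlgHom.toLinearMap_apply, AlgHom.toLinearMap_apply]
        exact hmul g h v) }
  have hρDv : ∀ (b : GL {a // p a} ℂ) (v : ↥SD), ((ρD b v : ↥SD) : MvPolynomial (MatIdx m × MatIdx m) ℂ) =
      MvPolynomial.aeval (R := ℂ) (fun q : MatIdx m × MatIdx m =>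
        ∑ l : MatIdx m, Matrix.reindex (Equiv.sumCompl p) (Equiv.sumCompl p)
          (Matrix.fromBlocks ((b⁻¹ : GL {a // p a} ℂ) : Matrix {a // p a} {a // p a} ℂ) 0 0
            (1 : Matrix {a // ¬ p a} {a // ¬ p a} ℂ)) q.1 l •
          (X (l, q.2) : MvPolynomial (MatIdx m × MatIdx m) ℂ)) (v : MvPolynomial (MatIdx m × MatIdx m) ℂ) :=
    fun _ _ => rfl
  let ρP : Representation ℂ (GL {a // p a} ℂ) ↥SP :=
    { toFun := fun b => (MvPolynomial.aeval (R := ℂ) (fun q : MatIdx m × MatIdx m =>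
          ∑ l : MatIdx m, Matrix.reindex (Equiv.sumCompl p) (Equiv.sumCompl p)
          (Matrix.fromBlocks ((b⁻¹ : GL {a // p a} ℂ) : Matrix {a // p a} {a // p a} ℂ) 0 0
            (1 : Matrix {a // ¬ p a} {a // ¬ p a} ℂ)) q.1 l •
            (X (l, q.2) : MvPolynomial (MatIdx m × MatIdx m) ℂ))).toLinearMap.restrict (hSP_stab b)
      map_one' := LinearMap.ext fun v => Subtype.ext (by
        rw [LinearMap.coe_restrict_apply, AlgHom.toLinearMap_apply, Module.End.one_apply]
        exact hone v)
      map_mul' := fun g h => LinearMap.ext fun v => Subtype.ext (by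
        rw [Module.End.mul_apply, LinearMap.coe_restrict_apply, LinearMap.coe_restrict_apply,
          LinearMap.coe_restrict_apply, AlgHom.toLinearMap_apply, AlgHom.toLinearMap_apply, AlgHom.toLinearMap_apply]
        exact hmul g h v) }
  have hρPv : ∀ (b : GL {a // p a} ℂ) (v : ↥SP), ((ρP b v : ↥SP) : MvPolynomial (MatIdx m × MatIdx m) ℂ) =
      MvPolynomial.aeval (R := ℂ) (fun q : MatIdx m × MatIdx m =>
        ∑ l : MatIdx m, Matrix.reindex (Equiv.sumCompl p) (Equiv.sumCompl p)
          (Matrix.fromBlocks ((b⁻¹ : GL {a // p a} ℂ) : Matrix {a // p a} {a // p a} ℂ) 0 0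
            (1 : Matrix {a // ¬ p a} {a // ¬ p a} ℂ)) q.1 l •
          (X (l, q.2) : MvPolynomial (MatIdx m × MatIdx m) ℂ)) (v : MvPolynomial (MatIdx m × MatIdx m) ℂ) :=
    fun _ _ => rfl
  -- rationality: matrix coefficients are polynomials in the entries of `b⁻¹`
  have hρDrat : IsRationalRep ρD := by
    refine isRationalRep_of_forall_exists_eval_inv fun v ψ₀ => ?_
    obtain ⟨ψ, hψ⟩ := LinearMap.exists_extend ψ₀
    obtain ⟨Q₀, hQ₀⟩ := hwx_exists_eval_eq_apply_leftAct (v : MvPolynomial (MatIdx m × MatIdx m) ℂ) ψ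
    obtain ⟨Q, hQ⟩ := frb_exists_eval_blk p Q₀
    refine ⟨Q, fun b => ?_⟩
    rw [← hψ, LinearMap.comp_apply, Submodule.subtype_apply]
    exact (congrArg ψ (hρDv b v)).trans ((hQ₀ (Matrix.reindex (Equiv.sumCompl p) (Equiv.sumCompl p)
      (Matrix.fromBlocks ((b⁻¹ : GL {a // p a} ℂ) : Matrix {a // p a} {a // p a} ℂ) 0 0
        (1 : Matrix {a // ¬ p a} {a // ¬ p a} ℂ)))).trans (hQ _))
  have hρPrat : IsRationalRep ρP := by
    refine isRationalRep_of_forall_exists_eval_inv fun v ψ₀ => ?_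
    obtain ⟨ψ, hψ⟩ := LinearMap.exists_extend ψ₀
    obtain ⟨Q₀, hQ₀⟩ := hwx_exists_eval_eq_apply_leftAct (v : MvPolynomial (MatIdx m × MatIdx m) ℂ) ψ
    obtain ⟨Q, hQ⟩ := frb_exists_eval_blk p Q₀
    refine ⟨Q, fun b => ?_⟩
    rw [← hψ, LinearMap.comp_apply, Submodule.subtype_apply]
    exact (congrArg ψ (hρPv b v)).trans ((hQ₀ (Matrix.reindex (Equiv.sumCompl p) (Equiv.sumCompl p)
      (Matrix.fromBlocks ((b⁻¹ : GL {a // p a} ℂ) : Matrix {a // p a} {a // p a} ℂ) 0 0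
        (1 : Matrix {a // ¬ p a} {a // ¬ p a} ℂ)))).trans (hQ _))
  -- the counting lemma for rational `GL(K)`-modules
  obtain ⟨χ₄, hχ₄⟩ := stub_multiplicityCount {a // p a} ↥SP ↥SD ρP ρD hρPrat hρDrat hgap
  -- per side: block-Borel semi-invariants of the per module are crux highest-weight vectors of weight `χ̃`
  have hper_borel : ∀ w : ↥SP, w ∈ highestWeightSpace ρP χ₄ →
      ∀ g : GL (MatIdx m) ℂ, IsUpperTriangular g →
        MvPolynomial.aeval (R := ℂ) (fun q : MatIdx m × MatIdx m =>
          ∑ l : MatIdx m, ((g⁻¹ : GL (MatIdx m) ℂ) : Matrix (MatIdx m) (MatIdx m) ℂ) q.1 l •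
            (X (l, q.2) : MvPolynomial (MatIdx m × MatIdx m) ℂ)) (w : MvPolynomial (MatIdx m × MatIdx m) ℂ) =
          weightChar (fun a : MatIdx m => if h : p a then χ₄ ⟨a, h⟩ else 0) g •
            (w : MvPolynomial (MatIdx m × MatIdx m) ℂ) := by
    intro w hw
    refine frb_borel_of_blockBorel p hp χ₄ (hSP_rows _ w.2) fun b hb => ?_
    exact congrArg Subtype.val ((mem_highestWeightSpace_iff _ _ _).mp hw b hb)
  -- a nonzero highest-weight vector on the per side pins the weight
  have hmult : hwMultiplicity ρP χ₄ ≠ 0 := fun h0 => (Nat.not_lt_zero _) (h0 ▸ hχ₄)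
  obtain ⟨w, hw0, hw⟩ := (hasHighestWeight_iff_exists _ _).mp
    ((hasHighestWeight_iff_hwMultiplicity_ne_zero _ _).mpr hmult)
  obtain ⟨F, hFh, hFw⟩ := Submodule.mem_map.mp (hSP_le w.2)
  have hw0' : genericOrbitMap (paddedPerFormLex ℂ n m) m F ≠ 0 := by
    intro h0
    apply hw0
    apply Subtype.ext
    rw [Submodule.coe_zero]
    exact hFw.symm.trans h0
  have hBw := hper_borel w hw
  rw [← hFw, AlgHom.toLinearMap_apply] at hBw
  obtain ⟨lam, hlamN, hχ⟩ := frb_exists_partition_of_hwv n δ _ hFh hw0' hBw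
  refine ⟨χ₄, lam, hlamN, hχ, ?_⟩
  -- per side: `hwMult_{χ₄}(S_P) ≤ mult_{λ*} ℂ[Δ_m(pp)]`
  haveI : Module.Finite ℂ ↥(MvPolynomial.homogeneousSubmodule (DegIdx (MatIdx m) m) ℂ δ) :=
    finite_homogeneousSubmodule _ _ _
  have hper_le : hwMultiplicity ρP χ₄ ≤
      orbitMultiplicity ℂ (paddedPerFormLex ℂ n m) m ((Weight.dualOfPartition (m * m) lam).toMatIdx : Weight (MatIdx m)) := by
    rw [hwMultiplicity, ← Submodule.finrank_map_subtype_eq, ← hχ]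
    refine le_trans (Submodule.finrank_mono ?_)
      (frb_finrank_hwsp_inf_map_le_orbitMultiplicity (paddedPerFormLex ℂ n m) hm0 _
        (MvPolynomial.homogeneousSubmodule (DegIdx (MatIdx m) m) ℂ δ))
    rintro _ ⟨u, hu, rfl⟩
    refine Submodule.mem_inf.mpr ⟨?_, hSP_le u.2⟩
    simp only [Submodule.mem_iInf, LinearMap.mem_ker, LinearMap.sub_apply, LinearMap.smul_apply,
      LinearMap.id_coe, id_eq, AlgHom.toLinearMap_apply, sub_eq_zero, Submodule.subtype_apply]
    exact hper_borel u hu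
  -- det side: `dim (S_D ⊓ HWSP(λ*)) ≤ hwMult_{χ₄}(S_D)`
  refine lt_of_le_of_lt ?_ (lt_of_lt_of_le hχ₄ hper_le)
  rw [hwMultiplicity, ← Submodule.finrank_map_subtype_eq]
  refine Submodule.finrank_mono ?_
  intro G hG
  obtain ⟨hGS, hG2⟩ := Submodule.mem_inf.mp hG
  refine Submodule.mem_map.mpr ⟨⟨G, hGS⟩, ?_, rfl⟩
  have hBG : ∀ g : GL (MatIdx m) ℂ, IsUpperTriangular g →
      MvPolynomial.aeval (R := ℂ) (fun q : MatIdx m × MatIdx m =>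
        ∑ l : MatIdx m, ((g⁻¹ : GL (MatIdx m) ℂ) : Matrix (MatIdx m) (MatIdx m) ℂ) q.1 l •
          (X (l, q.2) : MvPolynomial (MatIdx m × MatIdx m) ℂ)) G =
        weightChar (fun a : MatIdx m => if h : p a then χ₄ ⟨a, h⟩ else 0) g • G := by
    intro g hg
    have h1 := (Submodule.mem_iInf _).mp hG2 g
    have h2 := (Submodule.mem_iInf _).mp h1 hg
    rw [LinearMap.mem_ker, LinearMap.sub_apply, sub_eq_zero] at h2
    rw [hχ]
    exact h2
  show (⟨G, hGS⟩ : ↥SD) ∈ highestWeightSpace ρD χ₄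
  rw [mem_highestWeightSpace_iff]
  intro b hb
  apply Subtype.ext
  exact frb_blockBorel_of_borel p χ₄ hBG b hb

end

end Summit.ValiantsHypothesis.ValiantsHypothesis.Theorems.ValuativeFlip
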